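import Literature.NumberTheory.EllipticCurves.FormalGroupDictionaryProofs
import Literature.NumberTheory.EllipticCurves.FormalGroupXDerivativeProofs
import Literature.NumberTheory.EllipticCurves.FormalInvariantDerivation
import Literature.NumberTheory.EllipticCurves.PadicSeriesEvaluation
import Literature.NumberTheory.EllipticCurves.PadicFormalLogOrder
import Literature.NumberTheory.EllipticCurves.CanonicalPAdicHeightParallelogramProofs
import Literature.NumberTheory.EllipticCurves.Greenberg1999.TwoTorsionMuInvariant
import Summits.BirchSwinnertonDyer.BirchSwinnertonDyer.Theorems.Rank2ObservatoryKrausMinimality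
import HarnessLib

/-!
# The formal square root at `2`, I: `2`-adic preliminaries (line `nsf`, crux `StarOptBNSF`, stmt-BirchSwinnertonDyer-27047)

First of three files proving **the formal square-root lemma at `2`** (`exists_formalSqrt_half_integral`,
file `…FormalSqrtAtTwo`): for a globally minimal elliptic `W/ℚ` and a rational `2`-torsion abscissa `x₁`
FORMAL at `2` (`v₂(x₁) < 0`), the series `B = √(X(z) − x₁z²)` (`X = z²x(z) = formalXMulSq`, AEC IV.1),
`B(0) = 1`, has `2B ∈ ℤ⟦z⟧` — the `2`-adic heart of the `E`-level proof (THEOREM A″, HOME/p2/g34) of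
«Stevens' conjecture at `2`» for the `X₁(N)`-optimal curve: along the modular parametrisation the
anti-invariant function on the parity cover is `u = B(z(q))/z(q)`, so this lemma bounds the `2`-power
denominators fed to the unbounded-denominators theorem (tree `…CongruenceCore.false_of_antiinvariant_integral_cuspForm_wt`).

This file: power-series bookkeeping (`(1/(c − z))²`, coefficients of `U·(c − z)²`, peeling `coeff n (V²)`),
the norms at a formal `2`-torsion point `Q = (e, f) ∈ W(ℚ₂)` of a `2`-integral equation (`‖e‖ ≤ 4`, the
parameter `z_Q = −e/f` has `‖z_Q‖ = ½` and `‖2/z_Q‖ = 1`), and the two DICTIONARY facts at `z_Q`: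
`X(z_Q) = e z_Q²` (tree `padicEval_formalXMulSq_eq`) and **`X′(z_Q) = 2e z_Q`** (the tree's invariant-derivative
identity `z·ηX′ = 2ηX + z³(2y + a₁x + a₃)` evaluated where `2y + a₁x + a₃ = 0`).  Everything is proved;
no definitions, no named facts.  BSD is not proved by this file; nothing here reads `r_an`.
-/

set_option linter.dupNamespace false
set_option autoImplicit false

noncomputable section

open PowerSeries
open Literature.NumberTheory.EllipticCurves
open Summit.BirchSwinnertonDyer.BirchSwinnertonDyer.Rank2Observatory (padic_norm_two)

namespace Summit.BirchSwinnertonDyer.BirchSwinnertonDyer.Theorems.DepletionAtTwo.FormalSqrt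

/-! ### Power-series bookkeeping over a field -/

section Field

variable {K : Type*} [Field K]

/-- Coefficients of `(1/(c − z))² = Σ (k+1) c^{-(k+2)} z^k`. [folklore] -/
theorem coeff_invUnitsSub_sq (u : Kˣ) (k : ℕ) :
    coeff k (invUnitsSub u ^ 2) = (k + 1 : K) * ((u : K) ^ (k + 2))⁻¹ := by
  rw [sq, coeff_mul, Finset.Nat.sum_antidiagonal_eq_sum_range_succ
    (fun i j ↦ coeff i (invUnitsSub u) * coeff j (invUnitsSub u))]
  have hterm : ∀ i ∈ Finset.range (k + 1),
      coeff i (invUnitsSub u) * coeff (k - i) (invUnitsSub u) = ((u : K) ^ (k + 2))⁻¹ := by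
    intro i hi
    have hik : i ≤ k := Nat.lt_succ_iff.mp (Finset.mem_range.mp hi)
    rw [coeff_invUnitsSub, coeff_invUnitsSub, divp_eq_div, divp_eq_div, one_div, one_div,
      ← mul_inv, ← Units.val_mul, ← pow_add, show i + 1 + (k - i + 1) = k + 2 by omega,
      Units.val_pow_eq_pow_val]
  rw [Finset.sum_congr rfl hterm, Finset.sum_const, Finset.card_range, nsmul_eq_mul]
  push_cast
  ring

/-- `(c − z)² · (1/(c − z))² = 1`. [folklore] -/
theorem sub_sq_mul_invUnitsSub_sq (u : Kˣ) :
    (C (u : K) - X) ^ 2 * invUnitsSub u ^ 2 = 1 := by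
  rw [← mul_pow, mul_comm, invUnitsSub_mul_sub, one_pow]

/-- Coefficient `n + 2` of `U · (C c − X)²`. [folklore] -/
theorem coeff_mul_sub_sq (U : K⟦X⟧) (c : K) (n : ℕ) :
    coeff (n + 2) (U * (C c - X) ^ 2) =
      c ^ 2 * coeff (n + 2) U - 2 * c * coeff (n + 1) U + coeff n U := by
  have hexp : U * (C c - X) ^ 2 = C (c ^ 2) * U - C (2 * c) * (U * X) + U * X ^ 2 := by
    simp only [map_mul, map_pow, map_ofNat]
    ring
  rw [hexp, map_add, map_sub, coeff_C_mul, coeff_C_mul, coeff_mul_X_pow,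
    show n + 2 = (n + 1) + 1 from rfl, coeff_succ_mul_X]

/-- Coefficient `0` of `U · (C c − X)²` is `c² U₀`. [folklore] -/
theorem coeff_zero_mul_sub_sq (U : K⟦X⟧) (c : K) :
    coeff 0 (U * (C c - X) ^ 2) = c ^ 2 * coeff 0 U := by
  simp [coeff_zero_eq_constantCoeff, mul_comm]

/-- Peeling the two extreme terms off `coeff n (V²)`: for `n ≥ 1`,
`coeff n (V²) = 2 V₀ Vₙ + Σ_{0<i<n} Vᵢ V_{n−i}`. [folklore] -/
theorem coeff_sq_eq (V : K⟦X⟧) {n : ℕ} (hn : 1 ≤ n) :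
    coeff n (V ^ 2) = 2 * coeff 0 V * coeff n V +
      ∑ i ∈ Finset.Ioo 0 n, coeff i V * coeff (n - i) V := by
  rw [sq, coeff_mul, Finset.Nat.sum_antidiagonal_eq_sum_range_succ
    (fun i j ↦ coeff i V * coeff j V)]
  obtain ⟨m, rfl⟩ : ∃ m, n = m + 1 := ⟨n - 1, by omega⟩
  rw [Finset.sum_range_succ, Finset.sum_range_succ', Nat.sub_self, Nat.sub_zero,
    show Finset.Ioo 0 (m + 1) = (Finset.range m).image (· + 1) by
      ext i; simp only [Finset.mem_Ioo, Finset.mem_image, Finset.mem_range]; constructor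
      · intro h; exact ⟨i - 1, by omega, by omega⟩
      · rintro ⟨j, hj, rfl⟩; omega,
    Finset.sum_image (by intro a _ b _ h; simpa using h)]
  have : ∀ i ∈ Finset.range m, coeff (i + 1) V * coeff (m + 1 - (i + 1)) V =
      coeff (i + 1) V * coeff (m - i) V := by
    intro i hi; rw [show m + 1 - (i + 1) = m - i by omega]
  rw [Finset.sum_congr rfl this]
  ring

end Field

/-! ### The `2`-adic core -/

section Core

variable (W : WeierstrassCurve ℚ_[2]) [hW : W.IsIntegral ℤ_[2]]

/-- Ultrametric inequality for a difference in `ℚ₂`. [folklore] -/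
theorem norm_sub_le_max' (a b : ℚ_[2]) : ‖a - b‖ ≤ max ‖a‖ ‖b‖ := by
  simpa [sub_eq_add_neg] using IsUltrametricDist.norm_add_le_max a (-b)

/-- The `b`-invariants of a `2`-integral equation have norm `≤ 1`. [folklore] -/
theorem norm_b_le_one : ‖W.b₂‖ ≤ 1 ∧ ‖W.b₄‖ ≤ 1 ∧ ‖W.b₆‖ ≤ 1 := by
  have hV := W.eq_map_integralModel (p := 2)
  set V := W.integralModel ℤ_[2]
  refine ⟨?_, ?_, ?_⟩
  · rw [← hV, WeierstrassCurve.map_b₂]; exact PadicInt.norm_le_one _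
  · rw [← hV, WeierstrassCurve.map_b₄]; exact PadicInt.norm_le_one _
  · rw [← hV, WeierstrassCurve.map_b₆]; exact PadicInt.norm_le_one _

variable {W}
variable {e f : ℚ_[2]} (heq : W.toAffine.Equation e f) (htor : 2 * f + W.a₁ * e + W.a₃ = 0)
  (he : 1 < ‖e‖)

omit hW in
include heq htor in
/-- The `2`-division relation at a point of order `2`: `4e³ + b₂e² + 2b₄e + b₆ = 0`
(`(2y + a₁x + a₃)² = 4x³ + b₂x² + 2b₄x + b₆` on the curve). [Silverman AEC III.1, III.2.3(d)] [folklore] -/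
theorem two_division_relation : 4 * e ^ 3 + W.b₂ * e ^ 2 + 2 * W.b₄ * e + W.b₆ = 0 := by
  rw [WeierstrassCurve.Affine.equation_iff] at heq
  have h1 : (2 * f + W.a₁ * e + W.a₃) ^ 2 = 0 := by rw [htor]; ring
  simp only [WeierstrassCurve.b₂, WeierstrassCurve.b₄, WeierstrassCurve.b₆]
  linear_combination h1 - 4 * heq

include heq htor he in
/-- A formal `2`-torsion abscissa has `‖e‖ ≤ 4` (`v₂(x₁) = −2`; here only the easy half). [folklore] -/
theorem norm_e_le_four : ‖e‖ ≤ 4 := by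
  have norm_four_eq : ‖(4 : ℚ_[2])‖ = 4⁻¹ := by
    rw [show (4 : ℚ_[2]) = 2 * 2 by norm_num, norm_mul, padic_norm_two]; norm_num
  obtain ⟨hb₂, hb₄, hb₆⟩ := norm_b_le_one W
  have hrel := two_division_relation heq htor
  have h1e : 1 ≤ ‖e‖ := he.le
  have hkey : 4 * e ^ 3 = -(W.b₂ * e ^ 2 + 2 * W.b₄ * e + W.b₆) := by linear_combination hrel
  have hbound : ‖W.b₂ * e ^ 2 + 2 * W.b₄ * e + W.b₆‖ ≤ ‖e‖ ^ 2 := by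
    have hA : ‖W.b₂ * e ^ 2‖ ≤ ‖e‖ ^ 2 := by
      rw [norm_mul, norm_pow]; exact mul_le_of_le_one_left (by positivity) hb₂
    have hB : ‖2 * W.b₄ * e‖ ≤ ‖e‖ ^ 2 := by
      rw [norm_mul, norm_mul, padic_norm_two]
      calc 2⁻¹ * ‖W.b₄‖ * ‖e‖ ≤ 1 * 1 * ‖e‖ := by gcongr; norm_num
        _ = ‖e‖ ^ 1 := by ring
        _ ≤ ‖e‖ ^ 2 := pow_le_pow_right₀ h1e (by norm_num)
    have hCc : ‖W.b₆‖ ≤ ‖e‖ ^ 2 := hb₆.trans (one_le_pow₀ h1e)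
    refine (IsUltrametricDist.norm_add_le_max _ _).trans (max_le ?_ hCc)
    exact (IsUltrametricDist.norm_add_le_max _ _).trans (max_le hA hB)
  have h4 : ‖4 * e ^ 3‖ = 4⁻¹ * ‖e‖ ^ 3 := by rw [norm_mul, norm_pow, norm_four_eq]
  rw [hkey, norm_neg] at h4
  have h3 : 4⁻¹ * ‖e‖ ^ 3 ≤ ‖e‖ ^ 2 := h4 ▸ hbound
  have hpos : 0 < ‖e‖ ^ 2 := by positivity
  have h5 : ‖e‖ ^ 2 * ‖e‖ ≤ ‖e‖ ^ 2 * 4 := by nlinarith [h3]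
  exact le_of_mul_le_mul_left h5 hpos

include heq htor he in
/-- The parameter `z_Q = −e/f` of a formal `2`-torsion point and `t := 2/z_Q = a₁ + a₃/e`: `f ≠ 0`,
`z_Q ≠ 0`, `‖t‖ = 1`, `‖z_Q‖ = ½`. [Silverman AEC IV.1, VII.2.2] [folklore] -/
theorem param_norms : f ≠ 0 ∧ -e / f ≠ 0 ∧ ‖-e / f‖ < 1 ∧ ‖(2 : ℚ_[2]) / (-e / f)‖ = 1 ∧
    ‖-e / f‖ = 2⁻¹ := by
  obtain ⟨hf0, hz0, hz1, -, -⟩ := W.param_facts heq he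
  obtain ⟨ha₁, -, ha₃, -, -⟩ := W.norm_coeffs_le_one (p := 2)
  have he0 : e ≠ 0 := fun h ↦ by rw [h, norm_zero] at he; exact not_lt.mpr zero_le_one he
  set z : ℚ_[2] := -e / f with hz
  -- `t = 2/z = a₁ + a₃/e`
  have ht_eq : (2 : ℚ_[2]) / z = W.a₁ + W.a₃ / e := by
    have h2f : 2 * f = -(W.a₁ * e + W.a₃) := by linear_combination htor
    rw [hz]; field_simp; linear_combination -h2f
  have ht_le : ‖(2 : ℚ_[2]) / z‖ ≤ 1 := by
    rw [ht_eq]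
    refine (IsUltrametricDist.norm_add_le_max _ _).trans (max_le ha₁ ?_)
    rw [norm_div]; exact (div_le_one (by linarith)).mpr (ha₃.trans he.le)
  -- `‖t‖ = 1`: otherwise `2 ∣ t` in `ℤ₂` and `‖z‖ = ‖2‖/‖t‖ ≥ 1`
  have ht1 : ‖(2 : ℚ_[2]) / z‖ = 1 := by
    by_contra hne
    have hlt : ‖(2 : ℚ_[2]) / z‖ < 1 := lt_of_le_of_ne ht_le hne
    set tt : ℤ_[2] := ⟨(2 : ℚ_[2]) / z, ht_le⟩ with htt
    have hlt' : ‖tt‖ < 1 := by rw [PadicInt.norm_def]; exact hlt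
    rw [PadicInt.norm_lt_one_iff_dvd] at hlt'
    obtain ⟨s, hs⟩ := hlt'
    have hs' : (2 : ℚ_[2]) / z = 2 * (s : ℚ_[2]) := by
      have := congrArg (fun x : ℤ_[2] ↦ (x : ℚ_[2])) hs
      push_cast [htt] at this
      exact this
    have hs0 : (s : ℚ_[2]) ≠ 0 := by
      intro h0; rw [h0, mul_zero, div_eq_zero_iff] at hs'
      rcases hs' with h | h
      · norm_num at h
      · exact hz0 h
    have hzs : z = (s : ℚ_[2])⁻¹ := by
      have h2 : (2 : ℚ_[2]) ≠ 0 := by norm_num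
      have hinv : z⁻¹ = (s : ℚ_[2]) := by
        rw [div_eq_mul_inv] at hs'
        exact mul_left_cancel₀ h2 hs'
      rw [← hinv, inv_inv]
    have : 1 ≤ ‖z‖ := by
      rw [hzs, norm_inv]; exact one_le_inv_iff₀.mpr ⟨norm_pos_iff.mpr hs0, PadicInt.norm_le_one s⟩
    exact absurd hz1 (not_lt.mpr this)
  refine ⟨hf0, hz0, hz1, ht1, ?_⟩
  have h := ht1
  rw [norm_div, padic_norm_two, div_eq_one_iff_eq (norm_ne_zero_iff.mpr hz0)] at h
  exact h.symm

/-- `‖n‖ ≤ 1` for a natural number in `ℚ₂`. [folklore] -/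
theorem norm_natCast_le_one' (n : ℕ) : ‖(n : ℚ_[2])‖ ≤ 1 := by
  exact_mod_cast Padic.norm_int_le_one (p := 2) (n : ℤ)

/-- `η ∈ ℤ₂⟦z⟧` for a `2`-integral equation. [folklore] -/
theorem isPadicInt_formalEta : IsPadicInt W.formalEta := by
  rw [isPadicInt_iff_exists_powerSeries_map]
  exact ⟨(W.integralModel ℤ_[2]).formalEta, by
    rw [WeierstrassCurve.map_formalEta, W.eq_map_integralModel]⟩

/-- The derivative of a `2`-integral series is `2`-integral. [folklore] -/
theorem isPadicInt_derivative {F : ℚ_[2]⟦X⟧} (hF : IsPadicInt F) : IsPadicInt (d⁄dX ℚ_[2] F) := by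
  rw [isPadicInt_iff_coeff]
  intro n
  rw [coeff_derivative, norm_mul]
  have h1 := isPadicInt_iff_coeff.mp hF (n + 1)
  have h2 : ‖((n : ℚ_[2]) + 1)‖ ≤ 1 := by exact_mod_cast norm_natCast_le_one' (n + 1)
  exact mul_le_one₀ h1 (norm_nonneg _) h2

/-- `η(z) ≠ 0` at a point of the open unit disc (`η(0) = 1`). [folklore] -/
theorem padicEval_formalEta_ne_zero {z : ℚ_[2]} (hz : ‖z‖ < 1) : padicEval W.formalEta z ≠ 0 := by
  have hη := isPadicInt_formalEta (W := W)
  set η₁ : ℚ_[2]⟦X⟧ := 1 - W.formalEta with hη₁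
  have hη₁i : IsPadicInt η₁ := IsPadicInt.one.sub hη
  have hη₁0 : constantCoeff η₁ = 0 := by
    rw [hη₁, map_sub, map_one, WeierstrassCurve.constantCoeff_formalEta, sub_self]
  have hlt : ‖padicEval η₁ z‖ < 1 := norm_padicEval_lt_one hη₁i hη₁0 hz
  have hrew : W.formalEta = 1 - η₁ := by rw [hη₁, sub_sub_cancel]
  intro h0
  rw [hrew, padicEval_sub IsPadicInt.one hη₁i hz, padicEval_one, sub_eq_zero] at h0
  rw [← h0, norm_one] at hlt
  exact lt_irrefl _ hlt

include heq htor he in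
/-- **`X′(z_Q) = 2x₁z_Q`**: the derivative of the pole-cleared `x`-series at the parameter of a
`2`-torsion point of the kernel of reduction (the tree's `z·ηX′ = 2ηX + z³(2y + a₁x + a₃)` evaluated at
`z_Q`, where `2y + a₁x + a₃ = 0`). [Silverman AEC IV.1; Blakestad–Grant 2023 §2] [folklore] -/
theorem padicEval_derivative_formalXMulSq :
    padicEval (d⁄dX ℚ_[2] W.formalXMulSq) (-e / f) = 2 * e * (-e / f) := by
  obtain ⟨hf0, hz0, hz1, -, -⟩ := param_norms heq htor he
  obtain ⟨ha₁, -, ha₃, -, -⟩ := W.norm_coeffs_le_one (p := 2)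
  set z : ℚ_[2] := -e / f with hz
  have hX : IsPadicInt W.formalXMulSq := W.isPadicInt_formalXMulSq
  have hη : IsPadicInt W.formalEta := isPadicInt_formalEta (W := W)
  have hX' : IsPadicInt (d⁄dX ℚ_[2] W.formalXMulSq) := isPadicInt_derivative hX
  have h2 : IsPadicInt (C (2 : ℚ_[2]) : ℚ_[2]⟦X⟧) :=
    IsPadicInt.powerSeries_C (by rw [padic_norm_two]; norm_num)
  have hC₁ : IsPadicInt (C W.a₁ : ℚ_[2]⟦X⟧) := IsPadicInt.powerSeries_C ha₁
  have hC₃ : IsPadicInt (C W.a₃ : ℚ_[2]⟦X⟧) := IsPadicInt.powerSeries_C ha₃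
  have hXv : IsPadicInt (PowerSeries.X : ℚ_[2]⟦X⟧) := IsPadicInt.powerSeries_X
  have hI := W.X_mul_formalInvariantDerivation_formalXMulSq
  rw [WeierstrassCurve.formalInvariantDerivation_apply,
    show (2 : ℚ_[2]⟦X⟧) = C (2 : ℚ_[2]) from (map_ofNat C 2).symm] at hI
  have hXz : padicEval W.formalXMulSq z = e * z ^ 2 := W.padicEval_formalXMulSq_eq heq he
  have key := congrArg (fun G ↦ padicEval G z) hI
  rw [padicEval_mul hXv (hη.mul hX') hz1, padicEval_X, padicEval_mul hη hX' hz1,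
    padicEval_add ((h2.mul hη).mul hX) ((((hC₁.mul hXv).sub h2).mul hX).add (hC₃.mul (hXv.pow 3)))
      hz1,
    padicEval_mul (h2.mul hη) hX hz1, padicEval_mul h2 hη hz1, padicEval_C,
    padicEval_add (((hC₁.mul hXv).sub h2).mul hX) (hC₃.mul (hXv.pow 3)) hz1,
    padicEval_mul ((hC₁.mul hXv).sub h2) hX hz1, padicEval_sub (hC₁.mul hXv) h2 hz1,
    padicEval_mul hC₁ hXv hz1, padicEval_C, padicEval_X, padicEval_C,
    padicEval_mul hC₃ (hXv.pow 3) hz1, padicEval_C, padicEval_pow hXv hz1, padicEval_X, hXz] at key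
  -- the `2`-torsion relation kills the `Ỹ`-term
  have hzf : z * f = -e := by rw [hz]; field_simp
  have hY : (W.a₁ * z - 2) * (e * z ^ 2) + W.a₃ * z ^ 3 = 0 := by
    have : (W.a₁ * z - 2) * (e * z ^ 2) + W.a₃ * z ^ 3 = z ^ 2 * (z * (W.a₁ * e + W.a₃) - 2 * e) := by
      ring
    rw [this]
    have h2f : W.a₁ * e + W.a₃ = -(2 * f) := by linear_combination htor
    rw [h2f, show z * -(2 * f) - 2 * e = -2 * (z * f + e) by ring, hzf]
    ring
  have hηz := padicEval_formalEta_ne_zero (W := W) hz1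
  have hmain : z * padicEval W.formalEta z *
      (padicEval (d⁄dX ℚ_[2] W.formalXMulSq) z - 2 * e * z) = 0 := by
    linear_combination key + hY
  rcases mul_eq_zero.mp hmain with h | h
  · rcases mul_eq_zero.mp h with h' | h'
    · exact absurd h' hz0
    · exact absurd h' hηz
  · linear_combination h

end Core

end Summit.BirchSwinnertonDyer.BirchSwinnertonDyer.Theorems.DepletionAtTwo.FormalSqrt

end
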